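import Summits.CriticalPhenomena.PercolationContinuityZ3.Theorems.PercTiltedBlockersTiltComparisonFromXB
import Summits.CriticalPhenomena.PercolationContinuityZ3.Theorems.PercTiltedBlockersWideBoxFromTilt
import Summits.CriticalPhenomena.PercolationContinuityZ3.Theorems.PercNonProliferationSubpolynomialBlockingUniquenessCrossRoute
import HarnessLib

/-!
# Crux `PercTiltedBlockers.TiltComparison` (stmt-CriticalPhenomena-6393), line `registered` —
# the headline equivalences, BY NAME: `X_B ⟺ TiltComparison ∧ seed ⟺ HeightHalving ∧ seed`

Helper file of the lead (prover-line-stmt-CriticalPhenomena-6393-0); lands with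
`--supports stmt-CriticalPhenomena-6393`. Three-line compositions of LANDED theorems, recorded so that
the logical position of route `PercTiltedBlockers` is a single kernel-checked statement:

* `critAnnulusNonCrossing_iff_tiltComparison_and_cubeBlockingSeed` —
  `CritAnnulusNonCrossing (0846) ↔ TiltComparison (6393) ∧ CubeBlockingSeed (1141)`:
  (→) `tiltComparison_of_critAnnulusNonCrossing` (p151412) and the sibling
  `cubeBlockingSeed_of_critAnnulusNonCrossing` (p124521); (←) the route's PROVED supports
  `wideBoxFromTilt_proof` (tilt squaring, 40 steps) and `WideBoxToAnnulus_proof` (six walls).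
* `critAnnulusNonCrossing_of_heightHalving_of_cubeBlockingSeed`,
  `critAnnulusNonCrossing_iff_heightHalving_and_cubeBlockingSeed` — the same with the crux replaced
  by the single height-halving comparison `HH` (`tiltComparison_of_heightHalving`, p151087;
  `heightHalving_of_critAnnulusNonCrossing`, p151412): modulo the seed, `HH`, the crux and `X_B`
  are equivalent, so a planner may file `HH` in place of `TiltComparison` without loss.

The two `CubeBlockingSeed` decls of routes `PercAnnulusCrossing` / `PercTiltedBlockers` have the same
body (definitionally equal); statements use the `PercAnnulusCrossing` one. No new definitions.
-/

noncomputable section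

namespace Summit.CriticalPhenomena.PercolationContinuityZ3.Theorems.TiltComparison

open MeasureTheory
open Literature.Probability.Percolation Literature.Probability.LatticeModels
open Summit.CriticalPhenomena.PercolationContinuityZ3.Theorems.SubpolynomialBlocking

/-- **`X_B ⟺ TiltComparison ∧ CubeBlockingSeed`** (stmt-0846 ⟺ stmt-6393 ∧ stmt-1141, all decls
BY NAME). (→): `tiltComparison_of_critAnnulusNonCrossing`, `cubeBlockingSeed_of_critAnnulusNonCrossing`;
(←): `WideBoxToAnnulus_proof (wideBoxFromTilt_proof hT hS)` — the route's proved iteration and six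
walls. Route `PercTiltedBlockers` is therefore exactly a refactorisation of `X_B` into a comparison and
a seed. [folklore] -/
theorem critAnnulusNonCrossing_iff_tiltComparison_and_cubeBlockingSeed :
    Summit.CriticalPhenomena.PercolationContinuityZ3.Theses.PercAnnulusCrossing.CritAnnulusNonCrossing ↔
    (Summit.CriticalPhenomena.PercolationContinuityZ3.Theses.PercTiltedBlockers.TiltComparison ∧
      Summit.CriticalPhenomena.PercolationContinuityZ3.Theses.PercAnnulusCrossing.CubeBlockingSeed) :=
  ⟨fun h => ⟨tiltComparison_of_critAnnulusNonCrossing h,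
      SubpolynomialBlocking.cubeBlockingSeed_of_critAnnulusNonCrossing h⟩,
    fun h => WideBoxToAnnulus_proof (wideBoxFromTilt_proof h.1 h.2)⟩

/-- **`HH ∧ CubeBlockingSeed ⟹ X_B`**: the height-halving comparison at `p_c(ℤ³)` on the family
(hypothesis verbatim = that of `tiltComparison_of_heightHalving`) and the cube seed give
`CritAnnulusNonCrossing`, through `tiltComparison_of_heightHalving` and the route's proved
`wideBoxFromTilt_proof`, `WideBoxToAnnulus_proof`. [folklore] -/
theorem critAnnulusNonCrossing_of_heightHalving_of_cubeBlockingSeed :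
    (∃ g : ℝ → ℝ, Monotone g ∧ (∀ s, 0 < s → 0 < g s) ∧ ∀ m L M : ℕ, 1 ≤ m → 4 * m ≤ L →
      L ≤ 24 * m → 4 * m ≤ M → M ≤ 24 * m →
        g ((bondPercolation (zdGraph 3) (criticalProbI 3)).real
            {ω | ¬ ∃ x ∈ Finset.Icc (0 : Site 3) ![4 * (m : ℤ), L, M],
              ∃ y ∈ Finset.Icc (0 : Site 3) ![4 * (m : ℤ), L, M],
                x 0 = 0 ∧ y 0 = 4 * m ∧
                  ω ∈ openConnIn ↑(Finset.Icc (0 : Site 3) ![4 * (m : ℤ), L, M]) x y}) ≤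
          (bondPercolation (zdGraph 3) (criticalProbI 3)).real
            {ω | ¬ ∃ x ∈ Finset.Icc (0 : Site 3) ![2 * (m : ℤ), L, M],
              ∃ y ∈ Finset.Icc (0 : Site 3) ![2 * (m : ℤ), L, M],
                x 0 = 0 ∧ y 0 = 2 * m ∧
                  ω ∈ openConnIn ↑(Finset.Icc (0 : Site 3) ![2 * (m : ℤ), L, M]) x y}) →
    Summit.CriticalPhenomena.PercolationContinuityZ3.Theses.PercAnnulusCrossing.CubeBlockingSeed →
    Summit.CriticalPhenomena.PercolationContinuityZ3.Theses.PercAnnulusCrossing.CritAnnulusNonCrossing :=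
  fun hH hS => WideBoxToAnnulus_proof (wideBoxFromTilt_proof (tiltComparison_of_heightHalving hH) hS)

/-- **`X_B ⟺ HH ∧ CubeBlockingSeed`**: with `heightHalving_of_critAnnulusNonCrossing` (p151412) and
`cubeBlockingSeed_of_critAnnulusNonCrossing` (p124521). Modulo the seed (stmt-1141), the single
height-halving comparison, the crux `TiltComparison` and `X_B` are pairwise equivalent. [folklore] -/
theorem critAnnulusNonCrossing_iff_heightHalving_and_cubeBlockingSeed :
    Summit.CriticalPhenomena.PercolationContinuityZ3.Theses.PercAnnulusCrossing.CritAnnulusNonCrossing ↔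
    ((∃ g : ℝ → ℝ, Monotone g ∧ (∀ s, 0 < s → 0 < g s) ∧ ∀ m L M : ℕ, 1 ≤ m → 4 * m ≤ L →
      L ≤ 24 * m → 4 * m ≤ M → M ≤ 24 * m →
        g ((bondPercolation (zdGraph 3) (criticalProbI 3)).real
            {ω | ¬ ∃ x ∈ Finset.Icc (0 : Site 3) ![4 * (m : ℤ), L, M],
              ∃ y ∈ Finset.Icc (0 : Site 3) ![4 * (m : ℤ), L, M],
                x 0 = 0 ∧ y 0 = 4 * m ∧
                  ω ∈ openConnIn ↑(Finset.Icc (0 : Site 3) ![4 * (m : ℤ), L, M]) x y}) ≤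
          (bondPercolation (zdGraph 3) (criticalProbI 3)).real
            {ω | ¬ ∃ x ∈ Finset.Icc (0 : Site 3) ![2 * (m : ℤ), L, M],
              ∃ y ∈ Finset.Icc (0 : Site 3) ![2 * (m : ℤ), L, M],
                x 0 = 0 ∧ y 0 = 2 * m ∧
                  ω ∈ openConnIn ↑(Finset.Icc (0 : Site 3) ![2 * (m : ℤ), L, M]) x y}) ∧
      Summit.CriticalPhenomena.PercolationContinuityZ3.Theses.PercAnnulusCrossing.CubeBlockingSeed) :=
  ⟨fun h => ⟨heightHalving_of_critAnnulusNonCrossing h,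
      SubpolynomialBlocking.cubeBlockingSeed_of_critAnnulusNonCrossing h⟩,
    fun h => critAnnulusNonCrossing_of_heightHalving_of_cubeBlockingSeed h.1 h.2⟩

end Summit.CriticalPhenomena.PercolationContinuityZ3.Theorems.TiltComparison

end
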